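import Summits.SmoothPoincare4.SmoothPoincare4.Theses.SblfDescent
import Summits.SmoothPoincare4.SmoothPoincare4.Theorems.SblfDescentStepTwoReduction
import Summits.SmoothPoincare4.SmoothPoincare4.Theorems.SblfDescentRungOne
import Summits.SmoothPoincare4.SmoothPoincare4.Theorems.SblfDescentSblfExistsShield
import Summits.SmoothPoincare4.SmoothPoincare4.Theorems.StepTwo.Negative.SameMapObstruction
import Literature.Topology.FourManifolds.SimplifiedBrokenLefschetzFibration
import Literature.Topology.FourManifolds.GenusOneSblfOnSphereFourProofs

/-!
# Line `directed_bubble` on crux `SblfDescent.StepTwo` (stmt-SmoothPoincare4-18529)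

Forward ladder G4 (gen 3, seed stmt-SmoothPoincare4-18530 `SblfExists`): the DIRECTEDNESS-DEPTH dial —
"flower" broken Lefschetz fibrations.  Skeleton: `StepTwo_of` ⇐ `stub_bubbleDown` (GAP, hardest, no
located tool) + `stub_flowerTwoRecognition` (RUNG: two Lefschetz cycles on `Σ₂`, two folds) through the
landed `helper_stepTwo_of_genusTwoRecognition` and the PROVED ADK fibration of `S⁴`; floor
`flowerRecognition_zero_iff_rungOne` (F3), on-path `flowerRecognition_of_smoothPoincare4` (F4).
Honours `Cruxes/StepTwo/Disproof.lean`: `stepTwo_false_without_homotopySphere` (every statement keeps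
the hypothesis `X ≃ₕ S⁴`), `not_sameMap` / `Negative.SameMapObstruction` (`BubbleDown` asks for a NEW
map: the lower genus of a fixed map cannot change), `Negative.RefutationCost` (refuting the rung costs an
exotic sphere: `flowerTwoRecognition_of_smoothPoincare4`).

A *flower of height `h`* on an oriented smooth 4-manifold `X` is a broken Lefschetz fibration
`f : X → S²` with embedded critical image, connected fibres, exactly `h + 1` round (indefinite fold)
circles, a fibre of genus `h + 1`, a SPHERE fibre, every regular fibre of genus `≤ h + 1`, and all
Lefschetz points next to genus-`(h+1)` fibres.  Since a fold between connected fibres changes the genus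
by exactly one, the `h + 2` regions of `S² ∖ f(round)` are forced to be a CHAIN of nested discs /
annuli with genera `h+1, h, …, 1, 0`: the fibration is DIRECTED in the sense of Baykur–Saeki
(arXiv:1705.11169, §2) with sphere bottom.  On a homotopy 4-sphere the Euler count gives exactly
`2h` Lefschetz points (`χ = Σ_R χ(F_R) χ_c(R) + k = (2 - 2(h+1)) + 2 + k = 2`), HALF of the `4h`
of the simplified fibration of genus `h + 1` (lower genus `h`).

* height 0 = the simplified genus-one class of the route (`isFlower_zero_iff`): FLOOR, in print
  (Hayano 2011 Cor. 4.11; tree: `RungOne_of_sblfGenusOne`);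
* height 1 = `FlowerTwoRecognition`: genera 2 / 1 / 0, two round circles, two Lefschetz points —
  the RUNG (exists on `S⁴`: birth + two unsinks applied to the Auroux–Donaldson–Katzarkov fibration);
* `BubbleDown` = the GAP to `StepTwo`: a genus-2 simplified fibration (lower genus 1, four Lefschetz
  points) on a homotopy 4-sphere can be traded for a flower of height 1.
-/

set_option linter.dupNamespace false

namespace Summit.SmoothPoincare4.SmoothPoincare4.Cruxes.StepTwo.DirectedBubble

open scoped Manifold ContDiff Topology ContinuousMap
open Literature.Topology.FourManifolds
open Summit.SmoothPoincare4.SmoothPoincare4.Theses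
open Summit.SmoothPoincare4.SmoothPoincare4.Theorems

/-- A **flower of height `h`**: a broken Lefschetz fibration over `S²` with embedded critical image,
connected fibres of genus `≤ h + 1`, exactly `h + 1` round circles (the round locus off `L` is a union
of `h + 1` connected, mutually separated pieces), a genus-`(h+1)` fibre, a genus-`0` fibre, and the
Lefschetz points on the genus-`(h+1)` side.  Fields `contMDiff`, `surjective`, `lefschetz`, `fold`,
`injOn_crit`, `lefschetz_top` are those of `IsSimplifiedBrokenLefschetzFibration` verbatim. -/
structure IsFlowerBrokenLefschetzFibration {X : Type} [TopologicalSpace X]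
    [ChartedSpace (EuclideanSpace ℝ (Fin 4)) X] [IsManifold (𝓡 4) 1 X]
    (o : SmoothOrientation (𝓡 4) X) (f : X → Metric.sphere (0 : EuclideanSpace ℝ (Fin 3)) 1)
    (L : Finset X) (h : ℕ) : Prop where
  contMDiff : ContMDiff (𝓡 4) (𝓡 2) ∞ f
  surjective : Function.Surjective f
  lefschetz : ∀ p ∈ L, IsLefschetzCriticalPoint (𝓡 4) (𝓡 2) o f p true
  fold : ∀ p : X, ¬ Function.Surjective (mfderiv (𝓡 4) (𝓡 2) f p) → p ∉ L →
    ∃ (φ : OpenPartialHomeomorph X (EuclideanSpace ℝ (Fin 4)))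
      (ψ : OpenPartialHomeomorph (Metric.sphere (0 : EuclideanSpace ℝ (Fin 3)) 1) (EuclideanSpace ℝ (Fin 2))),
      p ∈ φ.source ∧ φ p = 0 ∧ Set.MapsTo f φ.source ψ.source ∧
      ContMDiffOn (𝓡 4) (𝓡 4) ∞ φ φ.source ∧ ContMDiffOn (𝓡 4) (𝓡 4) ∞ φ.symm φ.target ∧
      ContMDiffOn (𝓡 2) (𝓡 2) ∞ ψ ψ.source ∧ ContMDiffOn (𝓡 2) (𝓡 2) ∞ ψ.symm ψ.target ∧
      ∀ q ∈ φ.source, (ψ (f q)) 0 = (φ q) 0 ∧ (ψ (f q)) 1 = (φ q) 1 ^ 2 + (φ q) 2 ^ 2 - (φ q) 3 ^ 2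
  /-- exactly `h + 1` round circles: the round locus off `L` is the union of `h + 1` connected
  pieces, pairwise separated (so each piece is a connected component) -/
  round_components : ∃ C : Fin (h + 1) → Set X,
    (⋃ i, C i) = {p : X | ¬ Function.Surjective (mfderiv (𝓡 4) (𝓡 2) f p)} \ (↑L : Set X) ∧
    (∀ i, IsConnected (C i)) ∧ (∀ i j, i ≠ j → Disjoint (closure (C i)) (C j))
  injOn_crit : Set.InjOn f {p : X | ¬ Function.Surjective (mfderiv (𝓡 4) (𝓡 2) f p)}
  /-- regular fibres are connected of genus at most `h + 1` -/
  fibre : ∀ y, (∀ q, f q = y → Function.Surjective (mfderiv (𝓡 4) (𝓡 2) f q)) →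
    IsConnected (f ⁻¹' {y}) ∧ ∃ n : ℕ, n ≤ h + 1 ∧
      Nonempty ((Fin (2 * n) → ℤ) ≃ₗ[ℤ]
        Literature.AlgebraicTopology.SingularHomology.singularHomology ℤ ℤ ↥(f ⁻¹' {y}) 1)
  /-- some regular fibre has the top genus `h + 1` -/
  exists_top : ∃ y, (∀ q, f q = y → Function.Surjective (mfderiv (𝓡 4) (𝓡 2) f q)) ∧
    Nonempty ((Fin (2 * (h + 1)) → ℤ) ≃ₗ[ℤ]
      Literature.AlgebraicTopology.SingularHomology.singularHomology ℤ ℤ ↥(f ⁻¹' {y}) 1)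
  /-- some regular fibre is a sphere -/
  exists_sphere : ∃ y, (∀ q, f q = y → Function.Surjective (mfderiv (𝓡 4) (𝓡 2) f q)) ∧
    Nonempty ((Fin (2 * 0) → ℤ) ≃ₗ[ℤ]
      Literature.AlgebraicTopology.SingularHomology.singularHomology ℤ ℤ ↥(f ⁻¹' {y}) 1)
  /-- the Lefschetz points lie next to top-genus fibres -/
  lefschetz_top : ∀ p ∈ L, ∀ᶠ y in 𝓝 (f p),
    (∀ q, f q = y → Function.Surjective (mfderiv (𝓡 4) (𝓡 2) f q)) →
      Nonempty ((Fin (2 * (h + 1)) → ℤ) ≃ₗ[ℤ]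
        Literature.AlgebraicTopology.SingularHomology.singularHomology ℤ ℤ ↥(f ⁻¹' {y}) 1)

/-- FLOOR IDENTIFICATION: a flower of height `0` is exactly a simplified broken Lefschetz fibration of
genus one (lower genus `0`) in the tree's sense. [this file] -/
theorem isFlower_zero_iff {X : Type} [TopologicalSpace X]
    [ChartedSpace (EuclideanSpace ℝ (Fin 4)) X] [IsManifold (𝓡 4) 1 X]
    {o : SmoothOrientation (𝓡 4) X} {f : X → Metric.sphere (0 : EuclideanSpace ℝ (Fin 3)) 1}
    {L : Finset X} :
    IsFlowerBrokenLefschetzFibration o f L 0 ↔ IsSimplifiedBrokenLefschetzFibration o f L 0 := by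
  constructor
  · intro hF
    obtain ⟨C, hU, hC, -⟩ := hF.round_components
    have hC0 : C 0 = {p : X | ¬ Function.Surjective (mfderiv (𝓡 4) (𝓡 2) f p)} \ (↑L : Set X) := by
      rw [← hU]; ext x; simp [Set.mem_iUnion, Fin.exists_fin_one]
    refine ⟨hF.contMDiff, hF.surjective, hF.lefschetz, hF.fold, ?_, hF.injOn_crit, ?_,
      hF.exists_top, hF.exists_sphere, hF.lefschetz_top⟩
    · simpa [hC0] using hC 0
    · intro y hy
      obtain ⟨hconn, n, hn, hG⟩ := hF.fibre y hy
      refine ⟨hconn, ?_⟩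
      rcases Nat.le_one_iff_eq_zero_or_eq_one.mp (by omega : n ≤ 1) with rfl | rfl
      · exact Or.inr hG
      · exact Or.inl hG
  · intro hS
    refine ⟨hS.contMDiff, hS.surjective, hS.lefschetz, hS.fold, ?_, hS.injOn_crit, ?_,
      hS.exists_higher, hS.exists_lower, hS.lefschetz_higher⟩
    · refine ⟨fun _ => {p : X | ¬ Function.Surjective (mfderiv (𝓡 4) (𝓡 2) f p)} \ (↑L : Set X),
        ?_, fun _ => hS.isConnected_round, fun i j hij => absurd (Subsingleton.elim (α := Fin 1) i j) hij⟩
      ext x; simp [Set.mem_iUnion]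
    · intro y hy
      obtain ⟨hconn, hG⟩ := hS.fibre y hy
      rcases hG with hG | hG
      · exact ⟨hconn, 1, le_rfl, hG⟩
      · exact ⟨hconn, 0, Nat.zero_le _, hG⟩

/-- RUNG FAMILY (directedness-depth dial, recognition form): a smooth homotopy 4-sphere carrying a
flower of height `h` is diffeomorphic to `S⁴`.  `h = 0` is the route's `RungOne` (Hayano 2011,
Cor. 4.11, in print); `h = 1` is the rung `FlowerTwoRecognition`. -/
def FlowerRecognition (h : ℕ) : Prop :=
  ∀ (X : Type) [TopologicalSpace X] [T2Space X] [SecondCountableTopology X]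
    [ChartedSpace (EuclideanSpace ℝ (Fin 4)) X] [IsManifold (𝓡 4) ((⊤ : ℕ∞) : WithTop ℕ∞) X],
    X ≃ₕ Metric.sphere (0 : EuclideanSpace ℝ (Fin 5)) 1 →
    (∃ (o : SmoothOrientation (𝓡 4) X) (f : X → Metric.sphere (0 : EuclideanSpace ℝ (Fin 3)) 1)
        (L : Finset X), IsFlowerBrokenLefschetzFibration o f L h) →
    Nonempty (Diffeomorph (𝓡 4) (𝓡 4) X (Metric.sphere (0 : EuclideanSpace ℝ (Fin 5)) 1)
      ((⊤ : ℕ∞) : WithTop ℕ∞))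

/-- THE RUNG (height 1): a smooth homotopy 4-sphere with a broken Lefschetz fibration of genera
2 / 1 / 0 — two nested round circles, sphere fibres outside, genus-2 fibres inside, (necessarily two)
Lefschetz points on the genus-2 side — is diffeomorphic to `S⁴`.  Data: `(δ₁; c₁, c₂)` on `Σ₂` with
`t_{c₂} t_{c₁} (δ₁) = δ₁`, its cap `Φ_{δ₁}(t_{c₂} t_{c₁}) = ± t_{δ₂}^n` in `SL(2,ℤ)` (so
`i(c̄₁, c̄₂) ∈ {0, 2}`), round-handle framings; then Kirby calculus. -/
def FlowerTwoRecognition : Prop := FlowerRecognition 1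

/-- THE GAP to `StepTwo`: on a smooth homotopy 4-sphere, a simplified broken Lefschetz fibration of
genus 2 (lower genus 1, four Lefschetz points) can be traded for a flower of height 1 (two Lefschetz
points, one more round circle, a sphere fibre).  Implied by `StepTwo` (transport `S⁴`'s flower); as a
MOVE it is an inverse ("bubbling") move — every always-realisable base-diagram move raises genus
(Baykur–Saeki 2017 §3–4), and the local version "two parallel nodes = a bubble" is false. -/
def BubbleDown : Prop :=
  ∀ (X : Type) [TopologicalSpace X] [T2Space X] [SecondCountableTopology X]
    [ChartedSpace (EuclideanSpace ℝ (Fin 4)) X] [IsManifold (𝓡 4) ((⊤ : ℕ∞) : WithTop ℕ∞) X],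
    X ≃ₕ Metric.sphere (0 : EuclideanSpace ℝ (Fin 5)) 1 →
    (∃ (o : SmoothOrientation (𝓡 4) X) (f : X → Metric.sphere (0 : EuclideanSpace ℝ (Fin 3)) 1)
        (L : Finset X), IsSimplifiedBrokenLefschetzFibration o f L 1) →
    ∃ (o : SmoothOrientation (𝓡 4) X) (f : X → Metric.sphere (0 : EuclideanSpace ℝ (Fin 3)) 1)
        (L : Finset X), IsFlowerBrokenLefschetzFibration o f L 1

/-! ## Floor, on-path, composition (all sorry-free) -/

/-- F3 (instantiation): height 0 of the family is the route's `RungOne`, clause by clause.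
[this file] -/
theorem flowerRecognition_zero_iff_rungOne : FlowerRecognition 0 ↔ SblfDescent.RungOne := by
  constructor
  · intro hR M _ _ _ _ _ e hM
    obtain ⟨o, f, L, hS⟩ := (sblfDescent_has_zero_iff M).mpr hM
    exact hR M e ⟨o, f, L, isFlower_zero_iff.mpr hS⟩
  · intro h1 M _ _ _ _ _ e hM
    obtain ⟨o, f, L, hF⟩ := hM
    exact h1 M e ((sblfDescent_has_zero_iff M).mp ⟨o, f, L, isFlower_zero_iff.mp hF⟩)

/-- F3 WITNESS: the floor rung holds modulo the published genus-one classification (named fact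
`nonempty_diffeomorph_sphere_four_of_sblf_genus_one`, Hayano 2011 Cor. 4.11 / Baykur–Kamada 2015),
through the tree theorem `RungOne_of_sblfGenusOne`. [cite: Hayano2011, Cor. 4.11] -/
theorem flowerRecognition_zero_of_fact
    (H : nonempty_diffeomorph_sphere_four_of_sblf_genus_one) : FlowerRecognition 0 :=
  flowerRecognition_zero_iff_rungOne.mpr (RungOne_of_sblfGenusOne H)

/-- F4 ON-PATH: every rung of the family is a consequence of the summit (the fibration hypothesis is
discarded), so refuting `FlowerRecognition h` exhibits an exotic 4-sphere. [this file] -/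
theorem flowerRecognition_of_smoothPoincare4 (hS : _root_.SmoothPoincare4) (h : ℕ) :
    FlowerRecognition h := by
  intro X _ _ _ _ _ e _
  exact hS X ‹_› ‹_› e

/-- The rung is on-path. [this file] -/
theorem flowerTwoRecognition_of_smoothPoincare4 (hS : _root_.SmoothPoincare4) :
    FlowerTwoRecognition :=
  flowerRecognition_of_smoothPoincare4 hS 1

/-- Genus-2 recognition (the apex of line `Sketch`, = `StepTwo` modulo the ADK and Hayano facts by
`stepTwo_iff_genusTwoRecognition`) from bubbling + the rung. [this file] -/
theorem genusTwoRecognition_of_bubble (hB : BubbleDown) (hR : FlowerTwoRecognition) :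
    ∀ (X : Type) [TopologicalSpace X] [T2Space X] [SecondCountableTopology X]
      [ChartedSpace (EuclideanSpace ℝ (Fin 4)) X] [IsManifold (𝓡 4) ((⊤ : ℕ∞) : WithTop ℕ∞) X],
      X ≃ₕ Metric.sphere (0 : EuclideanSpace ℝ (Fin 5)) 1 →
      (∃ (o : SmoothOrientation (𝓡 4) X) (f : X → Metric.sphere (0 : EuclideanSpace ℝ (Fin 3)) 1)
          (L : Finset X), IsSimplifiedBrokenLefschetzFibration o f L 1) →
      Nonempty (Diffeomorph (𝓡 4) (𝓡 4) X (Metric.sphere (0 : EuclideanSpace ℝ (Fin 5)) 1)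
        ((⊤ : ℕ∞) : WithTop ℕ∞)) :=
  fun X _ _ _ _ _ e hX => hR X e (hB X e hX)

/-- LADDER COMPOSITION (sorry-free implication): gap + rung ⇒ the crux `StepTwo`, through the landed
reduction `helper_stepTwo_of_genusTwoRecognition` and the PROVED Auroux–Donaldson–Katzarkov
fibration of the round sphere (`exists_sblf_genus_one_noLefschetz_sphere_four_holds`). [this file] -/
theorem stepTwo_of_bubbleDown_of_flowerTwoRecognition (hB : BubbleDown)
    (hR : FlowerTwoRecognition) : SblfDescent.StepTwo :=
  helper_stepTwo_of_genusTwoRecognition (genusTwoRecognition_of_bubble hB hR)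
    exists_sblf_genus_one_noLefschetz_sphere_four_holds


/-! ## Registered stubs -/

/-- STUB (gap, hardest — no located tool; inverse "bubbling" move, necessarily global: the local trade
"two parallel nodes ↔ bubble" is false by Seiberg–Witten on K3): a genus-2 simplified broken Lefschetz
fibration on a homotopy 4-sphere can be traded for a flower of height 1.  Size XL.  Honours
`Disproof.not_sameMap`: the conclusion is a new map. -/
theorem stub_bubbleDown : BubbleDown := by
  sorry

/-- STUB (rung — the smallest open recognition cell: Hurwitz-type data `(δ₁; c₁, c₂ | δ₂; n)`,
`t_{c₂}t_{c₁}(δ₁) = δ₁`, cap `= ± t_{δ₂}^n` in `SL(2,ℤ)` forcing `i(c̄₁,c̄₂) ∈ {0,2}`; low-genus gluing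
data as in Hayano's genus-1 classification; Kirby calculus of `Σ₂×D² ∪ 2h² ∪ R₂(δ₁) ∪ (T²×A ∪ R₂(δ₂)
∪ S²×D²)`): a homotopy 4-sphere with a flower of height 1 is `S⁴`.  Size L–XL. -/
theorem stub_flowerTwoRecognition : FlowerTwoRecognition := by
  sorry

/-! ## Skeleton -/

/-- **COMPOSITION / SKELETON** (kernel-checked; the only sorries are the two registered stubs, used BY
NAME): bubble down (`stub_bubbleDown`), recognise the flower (`stub_flowerTwoRecognition`), transport
ADK's fibration through the landed reduction — concludes the crux BY NAME. -/
theorem StepTwo_of : Summit.SmoothPoincare4.SmoothPoincare4.Theses.SblfDescent.StepTwo :=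
  stepTwo_of_bubbleDown_of_flowerTwoRecognition stub_bubbleDown stub_flowerTwoRecognition

/-- The same composition with the stub STATEMENTS as hypotheses (sorry-free implication). -/
theorem stepTwo_of_statements :
    BubbleDown → FlowerTwoRecognition →
      Summit.SmoothPoincare4.SmoothPoincare4.Theses.SblfDescent.StepTwo :=
  stepTwo_of_bubbleDown_of_flowerTwoRecognition

end Summit.SmoothPoincare4.SmoothPoincare4.Cruxes.StepTwo.DirectedBubble
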